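import Summits.QuantumFields.BalabanUV.T4Continuum.Support.ShellMeasureLandauEndAssembledDecayCfLinCoTests
import Summits.QuantumFields.BalabanUV.T4Continuum.Support.ShellMeasureDecayKernelSchur

/-!
# `T4Continuum.ShellMeasureLandauEndAssembledDecayCfLinCoTestsSchur` — «WALL ROWS R06∕R09, THE w-TUPLE: THE THREE SUP-NORM OPERATOR
# BOUNDS ARE THE SCHUR TEST OF THEIR OWN DECAY ROWS»: S104 f4's most-assembled one-slot END (R11 + R10 + R05 supplied) RE-FIRED with
# `h𝒢w hH₁w hHw` DERIVED from the displayed decay rows `hk𝒢 hM𝒢′ ∕ hkH₁ hMH₁′ ∕ hkH hMH′` + `hδw` + ONE sign row `0 ≤ dis` + three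
# number junctions — AND (addendum A-ne7cL04g11-1) the three SIGN rows `he0 hLK hBd0` of (T3)∕(S78) DERIVED from their own neighbours
# `hEb`∕`hrE`, `hK`, `hA`∕`hpos`∕`hS` (nothing enters for them); everything else VERBATIM; conclusion IDENTICAL
(cell `pub-balaban`, sub-cell `t4`, spine estimate NE7c (node U5b); NE7c ROUND-2 crew `t4-ne7c-formalise-*`, unit
`b2b-balaban-t4-ne7c-formalise-leaf-04` gen 11, own initiative on the owner's ONE-CALL census `t4/b2b-balaban-t4-ne7c-p1/ONECALL-CENSUS-NE7c.md`
v1.8 rows R06∕R09 (journal INTENT∕OFFER l.21843; owner table `t4/b2b-balaban-t4-ne7c-p1/LEAVES-NE7c-P1.md` — the owner labels the row);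
ADDITIVE — imports S104 f4 `ShellMeasureLandauEndAssembledDecayCfLinCoTests` (p237394, leaf-10-g13) + this unit's f1 `ShellMeasureDecayKernelSchur`
ONLY; [folklore]; ONE END theorem + ONE numeric `example` (G-1), 0 `def`, 0 `def … : Prop`, 0 sorry, 0 citation tags)

HONEST FRAMING.  Finite four-torus programme, rung (B)+1 only — NOT infinite volume, NOT a mass gap, NOT the Clay problem, NOT
summit progress; (B), `BetaPertHyp`, (B^μ) not consumed.  NE7c (`T4IndicatorShell.ShellWeightBound` for the cell's expansions) is
NOT PRINTED in [Balaban 1983–89] and NOT PROVED; «NE7c ⇐ the named binders» (trigger c3); (M1) realized ≠ NE7c.  A JUNCTION ON OUR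
SIDE: three displayed binders of census class [T] (rows R06∕R09, WALL §3 W-a: the `L^∞ → L^∞` operator bounds of the w-tuple's
propagator `kerOp k𝒢`, coarse-datum map `kerOp kH₁` and minimiser map `kerOp kH`) are COROLLARIES of binders the same signature already
displays (their decay halves and reduced-rate row sums, [B9] Thm 3.13 ∕ (3.133) ∕ B11 (46)∕(73)∕(103) decay TYPE — W-a∕W-h, STAYING)
plus ONE structural sign row and three number relations; nothing of Bałaban's is asserted, cited or discharged; every estimate binder
of printed TYPE stays DISPLAYED.  HONEST DEPENDENCY (cell): continuum YM on T⁴ ⇐ BetaPertH ∧ nine spine estimates (0/9 proved);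
BetaPertH ⇐ (D1) ∧ (D4) ∧ CAP+tail; G-an2-4 gates asym, D1 and NE2/3/4.

THE POINT.  In S104 f4 (and in every END host since S80 f3, and in THE ONE CALL OF RECORD v3 `…UnionLevelsCfLin` l.150∕153∕155) the
w-tuple's four linear letters are NOT abstract maps: they are `kerOp` (S66 f3a) of the DISPLAYED kernels `k𝒢 kι kH kH₁`, and the
signature carries, besides the sup-norm rows
  `h𝒢w : ∀ V f, ‖kerOp (k𝒢 V) f‖ ≤ B₀w·‖f‖`, `hH₁w : ∀ V B, ‖kerOp (kH₁ V) B‖ ≤ B₀w·‖B‖`, `hHw : ∀ V X, ‖kerOp (kH V) X‖ ≤ B₀w·‖X‖`,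
their decay halves `hk𝒢 hkH₁ hkH : ‖k· V c b′‖ ≤ c·e^{−δ·dis(pos c, pos· b′)}` with the reduced-rate uniform sums
`hM𝒢′ hMH₁′ hMH′ : ∀ x, Σ_{b′} e^{−(δ·−δw)·dis(x, pos· b′)} ≤ M·`, the margin `hδw : 0 ≤ δw` and `0 ≤ c·, M·`.  By the `∞→∞` SCHUR TEST
(`ShellMeasureDecayKernelSums.norm_kerOp_le ∘ rowSum_le_of_decay`) and rate monotonicity on a NONNEGATIVE distance (f1
`ShellMeasureDecayKernelSchur.norm_kerOp_le_of_decay_junction_family`) the first group FOLLOWS from the second: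
`‖kerOp (k𝒢 V) f‖ ≤ c𝒢·M𝒢·‖f‖ ≤ B₀w·‖f‖` as soon as `c𝒢·M𝒢 ≤ B₀w`, and likewise for `kH₁`, `kH`.  THIS FILE re-fires S104 f4 BY NAME:
* LEAVING (6 hypotheses, census class [T]): `h𝒢w` (R06), `hH₁w`, `hHw` (R09) — the Schur junction; and `he0 : ∀ i ∈ I, 0 ≤ ee i`,
  `hLK : 0 ≤ LK`, `hBd0 : 0 ≤ Bd` (R15b) — three SIGN rows that are consequences of rows already displayed: `he0` from `hEb` at the
  ball's centre (`hrE`), `hLK` from `hK` (every summand `≥ 0`), `hBd0` from `hA` at the window centre `x = 0`, `c = ½` (any `ω`; and if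
  `Ω` is empty, `hpos` is false at `(1, 0, 1)` since `μ = 0`) — NOTHING enters for them.
* ENTERING: `hdis : ∀ x y, 0 ≤ dis x y` (ONE structural sign row on the w-tuple's position distance — designed-true for the coarse-
  blocked lattice distance of the reading of record, owner R-ne7cp1-g35-2 (a); NOT derivable from the one-sided Lipschitz row `hϖw`,
  f1 §3 `nonneg_dist_needed`) and the NUMBER JUNCTIONS `hB𝒢w : c𝒢·M𝒢 ≤ B₀w`, `hBH₁w : cH₁·MH₁ ≤ B₀w`, `hBHw : cH·MH ≤ B₀w` (the R10p
  pattern of S104 f1a∕f2: OUR constant inside a displayed letter; not printed inequalities).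
* VERBATIM: everything else of S104 f4 (box∕comb∕chart, density∕variable, the neighbours' co-test families, the three scheme tuples with
  R11 and R10 supplied, the kernels with their decay rows and sums, `hιw`, localities, read-outs, real structures, frozen plaquettes,
  (T3), (S78), numbers, (SM) in the Stokes currency, the γ3 pair); CONCLUSION IDENTICAL — (M1) at `εθ·η²` with the SAME slot constant
  (which already prices the letters at `c·M`: `cH₁·MH₁·bw ∕ ((1 − c𝒢M𝒢·(2C₄w a₃w e^{δw rW}))(1 − 2C₂R_C e^{δw rC}(cιMι)(cHMH)))`).
  Proof = the three sign rows derived in one line each, three `norm_kerOp_le_of_decay_junction_family` terms, then ONE call of S104 f4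
  BY NAME.  OWNER RULINGS: R-ne7cp1-g36-10 (b) (ROW S108 := leaf-04-g11) and R-ne7cp1-g36-12 (1) («FOLD» the sign rows; this file =
  LINK (1) of the junction wave (1) S108 f2 → (2) `…SchurElb` → (3) S110 coarse geometry → (4) S109 read-outs → (5) ONE re-fire of THE ONE CALL).
DELIBERATELY NOT RE-SOURCED: `hιw : ‖kerOp (kι V) Y‖ ≤ ‖Y‖` — the only Schur constant the displayed rows give it is `cι·Mι` (the
reduced-rate sum over ALL of `Λw`), and `cι·Mι ≤ 1` is not a faithful stand-in for a norm-one restriction-type letter; the u-∕e-tuples'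
`𝒢 Hop H₁ ιs 𝒢e He H₁e ιe` are ABSTRACT continuous linear maps with no kernel displayed — untouched.
JOINT INHABITATION (crew rule G-1): with `B₀w ≥ max(c𝒢M𝒢, cH₁MH₁, cHMH)` the number rows `hdomw hselfw hcontrw hqw hRCw` stay jointly
satisfiable (`X := ε₄w + B₀w·bw`: `hqW` and `hdomw` already give `4·c𝒢M𝒢·C₄w·X < 1`; `hselfw` follows from `bw ≤ 3ε₄w∕B₀w` once
`4B₀wC₄wX ≤ 1`; the host's `hk : 2·C2cov·landauRad·e^{δw rC}·(cιMι)·(cHMH) < 1` prices the SAME product `cH·MH` that `hBHw` now puts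
under `B₀w` — jointly inhabitable through a small `cι·Mι`, leaf-07-g10's INFO-2 C-ne7cleaf07g10-2); on the zero-kernel toys of
S96∕S106 (`c· = 0`) the four entering rows read `0 ≤ dis` and `0 ≤ B₀w` — the certificate
for THIS host is S104 f3's∕S106's composed with `le_of_lt hB₀w`-type trivialities (R-ne7cp1-g36-3 (d): one certificate per (host, purpose);
none is claimed here).
EXPECTED CENSUS EFFECT if THE ONE CALL is ever re-pointed here (the owner's two engines print the truth on the tree bytes): [T] −6
(R06 `h𝒢w`; R09 `hH₁w hHw`; R15b `he0 hLK hBd0`), [N] +3 (`hB𝒢w hBH₁w hBHw`), +1 sign row `hdis` (structural; the owner classes it).  HONEST: what would move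
is OUR hypothesis count — OUR separate booking of the `L^∞` corollary of decay rows that stay on the wall (in print, too, the sup-norm
operator bound of an exponentially decaying kernel IS its row sum); NOT a new located input; nothing of Bałaban's discharged.
WHAT THIS DOES NOT DO.  Discharge any decay row, any row sum, `hιw`, or any u-∕e-tuple operator bound; choose `B₀w`; assert a reading;
CONDITIONAL on every binder; NOT Bałaban's minimiser (node O); (M1) realized ≠ NE7c; NOTHING in the countdown moves; NE7c NOT PROVED.
-/

noncomputable section

open Set Metric NormedSpace MeasureTheory Function

namespace Summit.QuantumFields.BalabanUV.T4Continuum.ShellMeasureLandauEndAssembledDecayCfLinCoTestsSchur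

open scoped ENNReal
open Literature.MathematicalPhysics.QuantumFieldTheory.Balaban1983to89
open B11Prop6Scheme (Prop4Hyp)
open GaugeField (GaugeInvariant)
open T4ShellMeasure (SlotAntiConcentration)
open T4CubePoincare (cube)
open T4CubeChartGnomonic (SU2)
open T4CubeChartExp (expFibreChart)
open T4TreeGaugeFixing (fixTo)
open T4ShellMeasurePlaquette (expTail₂)
open ShellMeasureLevelAssembly (classifier)
open ShellMeasureMultiGridNorms (WSup)
open ShellMeasureMultiGridNorms.WSup (toPiL)
open ShellMeasurePinnedNorm (pinW)
open ShellMeasureLandauHolonomy (solAt landauExp)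
open ShellMeasureLandauHolonomyChart (holOf cplx)
open ShellMeasureLandauHolonomySkew (readOutReal)
open ShellMeasureDecayKernelSums (kerOp)
open ShellMeasureDecayKernelSchur (norm_kerOp_le_of_decay_junction_family)
open T4AxialGaugeSmallField (boxPlaqs boxBonds)
open T4AxialGaugeFixing (combBonds)
open B7Prop2Explicit (C0 c2' unitaryUnits)
open B7Prop1Local (pdevOn loK bondHiK)
open B7Prop5Flat (BondIn)
open ShellMeasureAverageProp4General (O1cov C2cov)
open ShellMeasureLandauCorrectionB7 (landauCf landauRad)
open ShellMeasureLandauCorrectionReal (skewPi)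
open ShellMeasureLandauCfBoxLocal (landauCfBox)
open ShellMeasureLandauEndAssembledDecayCfLinCoTests (slotAC_realized_su2_landauChart_assembled_decay_cfB7_lin_coTests)

section Box

open scoped Matrix.Norms.L2Operator

variable {P : Params} {j : ℕ} [DecidableEq (PBond P j)]
variable {n : Type*} [Fintype n] [DecidableEq n] [Nonempty n]
variable {𝒴 𝒵 ℬ : Type*} [NormedAddCommGroup 𝒴] [NormedSpace ℂ 𝒴] [CompleteSpace 𝒴]
  [NormedAddCommGroup 𝒵] [NormedSpace ℂ 𝒵] [NormedAddCommGroup ℬ] [NormedSpace ℂ ℬ]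
variable {𝔸 : Type*} [CStarAlgebra 𝔸] [Nontrivial 𝔸]

/-- **THE MOST-ASSEMBLED ONE-SLOT END WITH R11, R10, R05 SUPPLIED AND THE w-TUPLE's SUP-NORM ROWS DERIVED** — S104 f4
`…_cfB7_lin_coTests` BY NAME with `h𝒢w hH₁w hHw` obtained from the displayed decay rows by the Schur test
(`ShellMeasureDecayKernelSchur.norm_kerOp_le_of_decay_junction_family`); entering: the sign row `hdis` and the number junctions
`hB𝒢w hBH₁w hBHw`; the sign rows `he0 hLK hBd0` of (T3)∕(S78) derived from `hEb hK hA hpos`; everything else VERBATIM; conclusion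
IDENTICAL.  CONDITIONAL on every binder; readings NOT asserted; NOT Bałaban's minimiser (node O); (M1) realized ≠ NE7c. [folklore] -/
theorem slotAC_realized_su2_landauChart_assembled_decay_cfB7_lin_coTests_schur
    -- the BOX `[lo, hi]` (the block `□^{∼4}`: `nb` unit steps per direction, non-wrapping on the torus) and its axial comb
    {lo hi : Fin P.d → ℤ} {nb : ℕ} (hn : ∀ κ, hi κ ≤ lo κ + nb) (hN : ∀ κ, hi κ - lo κ < P.sitesPerDir j)
    (Λ : Finset (PBond P j)) (hΛbox : ∀ b ∈ Λ, b ∈ boxBonds lo hi) (hΛcomb : Disjoint Λ (combBonds lo hi))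
    {m₀ : ℕ} (e : ↥Λ × Fin 3 ≃ Fin m₀)
    {S : ℝ} (hS : 0 < S) (hSπ : 3 * S ^ 2 < Real.pi ^ 2)
    {F : GaugeField P j SU2 → ℝ≥0∞} (hF : Measurable F) (hFi : GaugeInvariant F)
    {u : GaugeField P j SU2 → ℝ} (hu : Measurable u) (hui : GaugeInvariant u)
    {ι : Type*} {Pu : Finset ι} (hPu : Pu.Nonempty)
    -- ══ R05 SUPPLIED (this file): window `W V := closedBall 0 S`, co-test `Jco V :=` the NEIGHBOURS' KEPT (2.17)-indicators on the
    -- S-ball (S94 `ShellMeasureCoTestStarShaped.jco_triple_of_neighbours`) — `hJW hJ hJ1 hWS` DISCHARGED; DISPLAYED in their place the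
    -- per-neighbour families: neighbours `N`, plaquettes `PuN`, holonomies `holN` read on OUR chart, thresholds∕radii∕bounds∕deltas,
    -- (SM)_i in S94's currency, and (AN-bound)_i on our rays (W-a TYPE — the straddling cubes' localized minimisers; displayed) ══
    {κN : Type*} (N : Finset κN) {ιN : κN → Type*} {PuN : (i : κN) → Finset (ιN i)} (hPuN : ∀ i, (PuN i).Nonempty)
    {AN : Type*} [NormedRing AN] [NormedAlgebra ℂ AN] [CompleteSpace AN]
    (holN : (i : κN) → GaugeField P j SU2 → ιN i → (Fin m₀ → ℝ) → AN) {θN RN HN δN : κN → ℝ}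
    (hRN : ∀ i ∈ N, 1 < RN i) (hθN : ∀ i ∈ N, 0 < θN i) (hδ0N : ∀ i ∈ N, 0 ≤ δN i) (hδ1N : ∀ i ∈ N, δN i ≤ 1)
    (hSMN : ∀ i ∈ N, 36 * HN i * 1 ^ 2 / (RN i - 1) ^ 2 ≤ δN i * θN i)
    (hANN : ∀ i ∈ N, ∀ V, ∀ x ∈ closedBall (0 : Fin m₀ → ℝ) S, ∀ p ∈ PuN i, ∃ f : ℂ → AN,
      DifferentiableOn ℂ f (ball 0 (RN i)) ∧ (∀ w ∈ ball (0 : ℂ) (RN i), ‖f w‖ ≤ HN i) ∧ f 0 = 0 ∧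
      ∀ c : ℝ, 0 ≤ c → c ≤ 1 → f (c : ℂ) = holN i V p (c • x) - 1)
    {δ ρ β : ℝ}
    (𝒢 : GaugeField P j SU2 → (𝒵 →L[ℂ] 𝒴)) (W𝒱 : GaugeField P j SU2 → 𝒴 → 𝒵) {B₀ C₄ a₃ ε₄ : ℝ}
    (h𝒢 : ∀ V f, ‖𝒢 V f‖ ≤ B₀ * ‖f‖) (hW : ∀ V, Prop4Hyp (W𝒱 V) C₄ a₃) (hB₀ : 0 < B₀) (hC₄ : 0 ≤ C₄)
    (hε₄ : 0 ≤ ε₄)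
    {dL C₁ B₃ ε₁ : ℝ} (hdL : 0 ≤ dL) (hC₁ : 0 ≤ C₁) (hε₁ : 0 ≤ ε₁) (hB₃ : dL ≤ B₃)
    (h1 : 2 * B₀ * C₁ * B₃ * ε₁ ≤ ε₄) (h2 : 4 * ε₄ ≤ a₃) (h3 : 16 * B₀ * C₄ * ε₄ ≤ 1)
    (H₁ : GaugeField P j SU2 → (ℬ →L[ℂ] 𝒴)) (hH₁ : ∀ V B, ‖H₁ V B‖ ≤ B₀ * ‖B‖)
    -- ══ R10 SUPPLIED (this file): the u-tuple's coarse-datum map IS a bounded complex-LINEAR map `T V` read on the chart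
    -- coordinates — its three analytic binders `hΦd hΦ0 hΦ` are DISCHARGED (`ShellMeasureLinearChartMap`); DISPLAYED in
    -- their place: ONE number relation «operator norm × polydisc radius < B11's `b = 2dLC₁ε₁`» ══
    (T : GaugeField P j SU2 → ((Fin m₀ → ℂ) →L[ℂ] ℬ)) {rΦ : ℝ} (hTb : ∀ V, ‖T V‖ * rΦ < 2 * dL * C₁ * ε₁) (hSr : S < rΦ)
    -- ══ R11 SUPPLIED (row S99, γ14): the THREE Landau-correction letters ARE the tree's `C_k` of [B7] Prop. 4 in the
    -- `A`-currency (S64 `landauCf`), all with `C₂ := C2cov d`, `RC := landauRad d L`: u-tuple (LOCALIZED, flat background —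
    -- its plaquette variables are words of the exponent field alone) `Cf V := (ball 0 RC).indicator (C_k(1, ·))`, NOTHING
    -- displayed in its place; w-tuple (GLOBAL minimiser, flat pi-types) `Cw V := landauCfBox L (Ubg V) k Sw Sw′ RC` (cut off
    -- PER OUTPUT BOND on its box — exact locality `hlocC` by `landauCfBox_local`); e-tuple (GLOBAL minimiser, pinned) `Ce V :=`
    -- CfP's conjugate of `C_k(Ubg V, ·)` with `C₂e := C2cov d·e^{2δ′r₀e}`.  `hC₂ hCq hCd hCr h𝓡𝒳 ∕ hC₂w hCqw hCdw hlocC hCrw h𝓡𝒳w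
    -- ∕ hC₂e hCqe hCde` DISCHARGED (f1 §5, f3a §2–§3).  DISPLAYED IN THEIR PLACE (w∕e only): the global minimiser's background
    -- `Ubg V` on `ℤᵈ` (unitary-valued) and its plaquette regularity ON THE BOXES of the two output index sets ONLY — `h52locw`,
    -- `h52loce` (B11 Thm 1 ∕ (19)–(21) TYPE, class T until node O reads it off the co-tests) — four LEVEL-FREE numbers on `α₀`
    -- (class D), the e-letter's two pin profiles with CfP's reach `r₀e` ([R]); [dict]: `k` = the slot's level ══
    (k : ℕ) (Sf Sf' Sw Sw' Se Se' : Finset (B7Prop1Explicit.Site P.d × Fin P.d))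
    (Ubg : GaugeField P j SU2 → B7Prop1Explicit.Site P.d → Fin P.d → 𝔸ˣ) (hUbg : ∀ V x κ, Ubg V x κ ∈ unitaryUnits 𝔸)
    {α₀ : ℝ} (hα : 0 < α₀) (hα3 : C0 P.d * α₀ ≤ 1 / 3) (hα4 : 4 * α₀ ≤ c2' P.d P.L) (hα6 : 4 * O1cov P.d * α₀ ≤ 1 / 3)
    (h52locw : ∀ V (c : ↥Sw'),
      pdevOn (loK P.L k c.1.1) (bondHiK P.L k c.1.1 c.1.2) (Ubg V) < α₀ * (((P.L : ℝ) ^ k)⁻¹) ^ 2)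
    (h52loce : ∀ V (c : ↥Se'),
      pdevOn (loK P.L k c.1.1) (bondHiK P.L k c.1.1 c.1.2) (Ubg V) < α₀ * (((P.L : ℝ) ^ k)⁻¹) ^ 2)
    (ϖe₁ : ↥Se → ℝ) (ϖe₂ : ↥Se' → ℝ) (hϖe₁ : ∀ b, 0 ≤ ϖe₁ b) (hϖe₂ : ∀ c, 0 ≤ ϖe₂ c) {r₀e : ℝ}
    (hreache : ∀ (c : ↥Se') (s : ↥Se),
      BondIn (loK P.L k c.1.1) (bondHiK P.L k c.1.1 c.1.2) s.1.1 s.1.2 → ϖe₂ c - r₀e ≤ ϖe₁ s)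
    (ιs : GaugeField P j SU2 → (𝒴 →L[ℂ] (↥Sf → 𝔸))) (hι : ∀ V Y, ‖ιs V Y‖ ≤ ‖Y‖)
    (Hop : GaugeField P j SU2 → ((↥Sf' → 𝔸) →L[ℂ] 𝒴)) (hH : ∀ V X, ‖Hop V X‖ ≤ B₀ * ‖X‖)
    {ε₃ : ℝ} (h18 : 18 * C2cov P.d * B₀ * ε₃ ≤ 1) (hcoup : ε₄ + B₀ * (2 * dL * C₁ * ε₁) ≤ ε₃)
    (h3R : 3 * ε₃ ≤ landauRad P.d P.L)
    (ℓs : ι → List (𝒴 →L[ℂ] Matrix n n ℂ)) {κr : ℝ} (hκ : 0 ≤ κr)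
    (hℓ : ∀ p ∈ Pu, ∀ ℓ ∈ ℓs p, ∀ Y, ‖ℓ Y‖ ≤ κr * ‖Y‖) {m : ℕ} (hlen : ∀ p ∈ Pu, (ℓs p).length ≤ m)
    {κc : ℝ} (hκc : 0 ≤ κc) (hcurl : ∀ p ∈ Pu, ∀ Y, ‖((ℓs p).map fun ℓ => ℓ Y).sum‖ ≤ κc * ‖Y‖)
    -- ══ (T2) THE WILSON SLOT'S SUPPLIER DATA AT THE READING OF RECORD (file 4
    -- `ShellMeasureLandauWilsonSquaresKernelsSchwarz.hE_landau_wilsonSquares_located_schwarz_of_decay`, per exterior section `V`,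
    -- V-uniform constants): five FLAT pi-type chain spaces, ONE pin profile on a common position space (one-sided Lipschitz),
    -- the four linear letters as V-indexed DECAY KERNELS with reduced-rate row sums ((3.133)∕Thm 3.3, (46), (103) decay-halves
    -- TYPE — LOCATORS), the flat printed-TYPE lists, two localities with reaches, the block support of the coarse field, blind
    -- flat read-outs, the located count — NOTHING PINNED DISPLAYED; the Wilson budget LOCATED and SECOND ORDER (γ6) ══
    {Λw Λz Λb 𝔖 : Type*} [Fintype Λw] [DecidableEq Λw] [Fintype Λz] [Fintype Λb]
    {𝔄w ℭ 𝔇 : Type*} [NormedAddCommGroup 𝔄w] [NormedSpace ℂ 𝔄w] [CompleteSpace 𝔄w]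
    [NormedAddCommGroup ℭ] [NormedSpace ℂ ℭ] [NormedAddCommGroup 𝔇] [NormedSpace ℂ 𝔇]
    {δw : ℝ} (hδw : 0 ≤ δw) (ϖw : 𝔖 → ℝ) (dis : 𝔖 → 𝔖 → ℝ) (hϖw : ∀ x y, ϖw x ≤ ϖw y + dis x y)
    -- ══ R06∕R09 w-TUPLE SUP-NORM ROWS SUPPLIED (this file): ONE structural sign row on the position distance ══
    (hdis : ∀ x y, 0 ≤ dis x y)
    (pos : Λw → 𝔖) (posz : Λz → 𝔖) (pos' : ↥Sw → 𝔖) (posx : ↥Sw' → 𝔖) (posb : Λb → 𝔖)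
    (k𝒢 : GaugeField P j SU2 → Λw → Λz → (ℭ →L[ℂ] 𝔄w)) (kι : GaugeField P j SU2 → ↥Sw → Λw → (𝔄w →L[ℂ] 𝔸))
    (kH : GaugeField P j SU2 → Λw → ↥Sw' → (𝔸 →L[ℂ] 𝔄w)) (kH₁ : GaugeField P j SU2 → Λw → Λb → (𝔇 →L[ℂ] 𝔄w))
    {c𝒢 δ𝒢 M𝒢 cι δι Mι cH δH MH cH₁ δH₁ MH₁ : ℝ}
    (hc𝒢 : 0 ≤ c𝒢) (hM𝒢 : 0 ≤ M𝒢) (hk𝒢 : ∀ V c b', ‖k𝒢 V c b'‖ ≤ c𝒢 * Real.exp (-(δ𝒢 * dis (pos c) (posz b'))))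
    (hM𝒢' : ∀ x, ∑ b', Real.exp (-((δ𝒢 - δw) * dis x (posz b'))) ≤ M𝒢)
    (hcι : 0 ≤ cι) (hMι : 0 ≤ Mι) (hkι : ∀ V c b', ‖kι V c b'‖ ≤ cι * Real.exp (-(δι * dis (pos' c) (pos b'))))
    (hMι' : ∀ x, ∑ b', Real.exp (-((δι - δw) * dis x (pos b'))) ≤ Mι)
    (hcH : 0 ≤ cH) (hMH : 0 ≤ MH) (hkH : ∀ V c b', ‖kH V c b'‖ ≤ cH * Real.exp (-(δH * dis (pos c) (posx b'))))
    (hMH' : ∀ x, ∑ b', Real.exp (-((δH - δw) * dis x (posx b'))) ≤ MH)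
    (hcH₁ : 0 ≤ cH₁) (hMH₁ : 0 ≤ MH₁) (hkH₁ : ∀ V c b', ‖kH₁ V c b'‖ ≤ cH₁ * Real.exp (-(δH₁ * dis (pos c) (posb b'))))
    (hMH₁' : ∀ x, ∑ b', Real.exp (-((δH₁ - δw) * dis x (posb b'))) ≤ MH₁)
    -- the flat lists (P4)∕(118)∕(121)∕(75)-TYPE∕(44) at radius `RCw` with `6(ε₄w + B₀w·bw) ≤ RCw`∕scaling∕(54); ══ THIS FILE: the
    -- three sup-norm operator rows `h𝒢w hH₁w hHw` of S104 f4 are DERIVED (Schur test of the decay rows above) — in their place the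
    -- NUMBER JUNCTIONS `c𝒢·M𝒢 ≤ B₀w`, `cH₁·MH₁ ≤ B₀w`, `cH·MH ≤ B₀w` ══
    (W𝒱w : GaugeField P j SU2 → (Λw → 𝔄w) → (Λz → ℭ)) {B₀w C₄w a₃w ε₄w bw : ℝ}
    (hB𝒢w : c𝒢 * M𝒢 ≤ B₀w) (hWw : ∀ V, Prop4Hyp (W𝒱w V) C₄w a₃w) (hB₀w : 0 < B₀w) (hC₄w : 0 ≤ C₄w)
    (hε₄w : 0 ≤ ε₄w) (hdomw : 2 * (ε₄w + B₀w * bw) ≤ a₃w) (hselfw : B₀w * C₄w * (ε₄w + B₀w * bw) ^ 2 ≤ ε₄w)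
    (hcontrw : 4 * B₀w * C₄w * (ε₄w + B₀w * bw) < 1) (hBH₁w : cH₁ * MH₁ ≤ B₀w)
    -- ══ R10 SUPPLIED: the w-tuple's coarse-datum map is a bounded LINEAR map into the flat pi-type; ONE number relation ══
    (Tw : GaugeField P j SU2 → ((Fin m₀ → ℂ) →L[ℂ] (Λb → 𝔇))) {rΦw : ℝ} (hTbw : ∀ V, ‖Tw V‖ * rΦw < bw)
    (h2Sw : 2 * S ≤ rΦw)
    (hιw : ∀ V Y, ‖kerOp (kι V) Y‖ ≤ ‖Y‖) (hBHw : cH * MH ≤ B₀w)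
    (hqw : 9 * C2cov P.d * B₀w * (ε₄w + B₀w * bw) < 1) (hRCw : 6 * (ε₄w + B₀w * bw) ≤ landauRad P.d P.L)
    -- localities with reaches, the block support, the two contraction numbers (DISPLAYED arithmetic on the decay constants)
    (NW : Λz → Λw → Prop)
    (hlocW : ∀ V, ∀ A A' : Λw → 𝔄w, ∀ c', (∀ b', NW c' b' → A b' = A' b') → W𝒱w V A c' = W𝒱w V A' c')
    {rW : ℝ} (hreachW : ∀ c' b', NW c' b' → ϖw (posz c') - rW ≤ ϖw (pos b'))
    {rC : ℝ} (hreachC : ∀ (c' : ↥Sw') (b' : ↥Sw),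
      BondIn (loK P.L k c'.1.1) (bondHiK P.L k c'.1.1 c'.1.2) b'.1.1 b'.1.2 → ϖw (posx c') - rC ≤ ϖw (pos' b'))
    (hsupp : ∀ V, ∀ z : Fin m₀ → ℂ, ∀ i, 0 < ϖw (posb i) → Tw V z i = 0)
    (hqW : c𝒢 * M𝒢 * (2 * C₄w * a₃w * Real.exp (δw * rW)) < 1)
    (hk : 2 * C2cov P.d * landauRad P.d P.L * Real.exp (δw * rC) * (cι * Mι) * (cH * MH) < 1)
    -- weight plaquettes; read-outs BLIND off located supports, FLAT op-norms, curl op-norm (DISPLAYED; `κ_c ∝ η²`), lengths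
    {𝔭 : Type*} (Pw : Finset 𝔭) (ℓw : 𝔭 → List ((Λw → 𝔄w) →L[ℂ] Matrix n n ℂ)) (suppw : 𝔭 → Finset Λw)
    (ϖPw : 𝔭 → ℝ)
    (hblindw : ∀ p ∈ Pw, ∀ ℓ ∈ ℓw p, ∀ A A' : Λw → 𝔄w, (∀ b' ∈ suppw p, A b' = A' b') → ℓ A = ℓ A')
    (hdepthw : ∀ p ∈ Pw, ∀ b' ∈ suppw p, ϖPw p ≤ ϖw (pos b')) (hϖPw : ∀ p ∈ Pw, 0 ≤ ϖPw p)
    {κwb κcb : ℝ} (hκwb : 0 ≤ κwb) (hκcb : 0 ≤ κcb) (hℓwb : ∀ p ∈ Pw, ∀ ℓ ∈ ℓw p, ‖ℓ‖ ≤ κwb)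
    (hcurlw : ∀ p ∈ Pw, ‖(ℓw p).sum‖ ≤ κcb)
    {mw : ℕ} (hlenw : ∀ p ∈ Pw, (ℓw p).length ≤ mw)
    -- the global tuple's real structure with SKEW weight read-outs
    (𝓡𝒴w : AddSubgroup (Λw → 𝔄w)) (h𝓡𝒴w : IsClosed (𝓡𝒴w : Set (Λw → 𝔄w))) (𝓡𝒵w : AddSubgroup (Λz → ℭ))
    (𝓡ℬw : AddSubgroup (Λb → 𝔇))
    (h𝒢rw : ∀ V, ∀ f ∈ 𝓡𝒵w, kerOp (k𝒢 V) f ∈ 𝓡𝒴w) (hWrw : ∀ V, ∀ Y ∈ 𝓡𝒴w, W𝒱w V Y ∈ 𝓡𝒵w)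
    (hιrw : ∀ V, ∀ Y ∈ 𝓡𝒴w, kerOp (kι V) Y ∈ skewPi ↥Sw)
    (hHrw : ∀ V, ∀ X ∈ skewPi (𝔸 := 𝔸) ↥Sw', kerOp (kH V) X ∈ 𝓡𝒴w)
    (hH₁rw : ∀ V, ∀ B ∈ 𝓡ℬw, kerOp (kH₁ V) B ∈ 𝓡𝒴w)
    (hTrw : ∀ V (y : Fin m₀ → ℝ), Tw V (cplx y) ∈ 𝓡ℬw)
    (hskew : ∀ p ∈ Pw, ∀ ℓ ∈ ℓw p, ∀ Y ∈ 𝓡𝒴w, ℓ Y ∈ skewAdjoint (Matrix n n ℂ))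
    -- the frozen background plaquettes (N-ne7cp1-g31-2) with a uniform size bound, the located count, `0 ≤ β`
    (Bp : GaugeField P j SU2 → 𝔭 → Matrix n n ℂ) {d : 𝔭 → ℝ} {dbar : ℝ}
    (hBu : ∀ V, ∀ p ∈ Pw, Bp V p ∈ unitary (Matrix n n ℂ)) (hBd : ∀ V, ∀ p ∈ Pw, ‖Bp V p - 1‖ ≤ d p)
    (hd : ∀ p ∈ Pw, d p ≤ dbar) (hdbar : 0 ≤ dbar)
    {Kw : ℝ} (hKw : ∑ p ∈ Pw, Real.exp (-(δw * ϖPw p)) ≤ Kw)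
    -- ══ (T3) THE LOCATED NON-WILSON TERMS' SUPPLIER DATA (S71 f2 `hE_landau_chartRay_pinned`): the global tuple's PINNED
    -- INSTANCE `𝒴 := WSup (pinW δ′ ϖ) 1 𝔄`, located per-term functionals, pin depths, located sum `LK`, coupling ══
    {Λe : Type*} [Fintype Λe] {𝔄 : Type*} [NormedAddCommGroup 𝔄] [NormedSpace ℂ 𝔄] [CompleteSpace 𝔄] {δ' : ℝ} {ϖ : Λe → ℝ}
    (hδ' : 0 ≤ δ') (hϖ : ∀ b', 0 ≤ ϖ b')
    {𝒵e ℬe : Type*} [NormedAddCommGroup 𝒵e] [NormedSpace ℂ 𝒵e] [NormedAddCommGroup ℬe] [NormedSpace ℂ ℬe]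
    (𝒢e : GaugeField P j SU2 → (𝒵e →L[ℂ] WSup (pinW δ' ϖ) 1 𝔄)) (W𝒱e : GaugeField P j SU2 → WSup (pinW δ' ϖ) 1 𝔄 → 𝒵e)
    {B₀e C₄e a₃e be ε₄e : ℝ}
    (h𝒢e : ∀ V f, ‖𝒢e V f‖ ≤ B₀e * ‖f‖) (hWe : ∀ V, Prop4Hyp (W𝒱e V) C₄e a₃e) (hB₀e : 0 < B₀e) (hC₄e : 0 ≤ C₄e)
    (hbe : 0 ≤ be) (hε₄e : 0 ≤ ε₄e) (hdome : 2 * (ε₄e + B₀e * be) ≤ a₃e)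
    (hselfe : B₀e * C₄e * (ε₄e + B₀e * be) ^ 2 ≤ ε₄e) (hcontre : 4 * B₀e * C₄e * (ε₄e + B₀e * be) < 1)
    (H₁e : GaugeField P j SU2 → (ℬe →L[ℂ] WSup (pinW δ' ϖ) 1 𝔄)) (hH₁e : ∀ V B, ‖H₁e V B‖ ≤ B₀e * ‖B‖)
    -- ══ R10 SUPPLIED: the e-tuple's coarse-datum map is a bounded LINEAR map; ONE number relation ══
    (Te : GaugeField P j SU2 → ((Fin m₀ → ℂ) →L[ℂ] ℬe)) {rΦe : ℝ} (hTbe : ∀ V, ‖Te V‖ * rΦe < be) (hSre : S < rΦe)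
    (ιe : GaugeField P j SU2 → (WSup (pinW δ' ϖ) 1 𝔄 →L[ℂ] WSup (pinW δ' ϖe₁) 1 𝔸)) (hιe : ∀ V Y, ‖ιe V Y‖ ≤ ‖Y‖)
    (He : GaugeField P j SU2 → (WSup (pinW δ' ϖe₂) 1 𝔸 →L[ℂ] WSup (pinW δ' ϖ) 1 𝔄)) (hHe : ∀ V X, ‖He V X‖ ≤ B₀e * ‖X‖)
    (hqe : 9 * (C2cov P.d * Real.exp (2 * δ' * r₀e)) * B₀e * (ε₄e + B₀e * be) < 1)
    (hRCe : 3 * (ε₄e + B₀e * be) ≤ landauRad P.d P.L)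
    {𝔱 : Type*} (I : Finset 𝔱) {Ef : 𝔱 → (Λe → 𝔄) → ℂ} {rE : ℝ} {ee : 𝔱 → ℝ} (hrE : 0 < rE)
    (hEd : ∀ i ∈ I, DifferentiableOn ℂ (Ef i) (ball 0 rE))
    (hEb : ∀ i ∈ I, ∀ Z ∈ ball (0 : Λe → 𝔄) rE, ‖Ef i Z‖ ≤ ee i)
    (supp : 𝔱 → Finset Λe) (hblind : ∀ i ∈ I, ∀ A₁ A₂ : Λe → 𝔄, (∀ b' ∈ supp i, A₁ b' = A₂ b') → Ef i A₁ = Ef i A₂)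
    (ϖP : 𝔱 → ℝ) (hdepth : ∀ i ∈ I, ∀ b' ∈ supp i, ϖP i ≤ ϖ b')
    {LK : ℝ} (hK : ∑ i ∈ I, 2 * ee i / rE * Real.exp (-(δ' * ϖP i)) ≤ LK)
    (hcoupE : ((ε₄e + B₀e * be) + B₀e * (4 * (C2cov P.d * Real.exp (2 * δ' * r₀e)) * (ε₄e + B₀e * be) ^ 2)) ≤ rE / 2)
    {BE₁ : ℝ} (hElb₁ : ∀ V (y : Fin m₀ → ℝ), ‖y‖ ≤ S → -BE₁ ≤
      (∑ i ∈ I, Ef i (WSup.toPiL (𝔄 := 𝔄) (pinW δ' ϖ) 1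
        (landauExp (fun Y : WSup (pinW δ' ϖe₁) 1 𝔸 =>
            ((toPiL (pinW δ' ϖe₂) 1).symm (landauCf P.L (Ubg V) k Se Se' (toPiL (pinW δ' ϖe₁) 1 Y)) :
              WSup (pinW δ' ϖe₂) 1 𝔸)) (ιe V) (He V)
            (4 * (C2cov P.d * Real.exp (2 * δ' * r₀e)) * (ε₄e + B₀e * be) ^ 2)
          (solAt (𝒢e V) 0 (W𝒱e V) ε₄e (0 : 𝒵e) (H₁e V (Te V (cplx y))) + H₁e V (Te V (cplx y)))))).re)
    -- ══ (S78) THE FLUCTUATION-DRESSED TERMS: `−log ∫ g e^{A} dμ` with an ω-UNIFORM ray constant `B_d`, integrability and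
    -- positivity of the dressed integral, a lower bound on the S-ball (all DISPLAYED) ══
    {Ω : Type*} [MeasurableSpace Ω] (μ : Measure Ω) {g : Ω → ℝ} (hg : ∀ ω, 0 ≤ g ω)
    (A : GaugeField P j SU2 → (Fin m₀ → ℝ) → Ω → ℝ) {Bd : ℝ}
    (hint : ∀ V, ∀ x ∈ closedBall (0 : Fin m₀ → ℝ) S, ∀ c : ℝ, 1 / 2 ≤ c → c ≤ 1 →
      Integrable (fun ω => g ω * Real.exp (A V (c • x) ω)) μ)
    (hpos : ∀ V, ∀ x ∈ closedBall (0 : Fin m₀ → ℝ) S, ∀ c : ℝ, 1 / 2 ≤ c → c ≤ 1 →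
      0 < ∫ ω, g ω * Real.exp (A V (c • x) ω) ∂μ)
    (hA : ∀ V, ∀ x ∈ closedBall (0 : Fin m₀ → ℝ) S, ∀ c : ℝ, 1 / 2 ≤ c → c ≤ 1 →
      ∀ ω, A V x ω ≤ A V (c • x) ω + (1 - c) * Bd)
    {BE₂ : ℝ} (hElb₂ : ∀ V (y : Fin m₀ → ℝ), ‖y‖ ≤ S → -BE₂ ≤ (-Real.log (∫ ω, g ω * Real.exp (A V y ω) ∂μ)))
    (L : Set (𝒴 →L[ℂ] Matrix n n ℂ))
    (𝓡𝒵 : AddSubgroup 𝒵) (𝓡ℬ : AddSubgroup ℬ)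
    (h𝒢r : ∀ V, ∀ f ∈ 𝓡𝒵, 𝒢 V f ∈ readOutReal L) (hWr : ∀ V, ∀ Y ∈ readOutReal L, W𝒱 V Y ∈ 𝓡𝒵)
    (hιr : ∀ V, ∀ Y ∈ readOutReal L, ιs V Y ∈ skewPi ↥Sf)
    (hHr : ∀ V, ∀ X ∈ skewPi (𝔸 := 𝔸) ↥Sf', Hop V X ∈ readOutReal L)
    (hH₁r : ∀ V, ∀ B ∈ 𝓡ℬ, H₁ V B ∈ readOutReal L)
    (hTr : ∀ V (y : Fin m₀ → ℝ), T V (cplx y) ∈ 𝓡ℬ)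
    (hRdict : ∀ V, ∀ x ∈ cube m₀ S,
      F (fixTo (combBonds lo hi) 1 (updateFinset V Λ (expFibreChart Λ 1 e x))) =
        (closedBall (0 : Fin m₀ → ℝ) S ∩ ⋂ i ∈ N, {y | classifier (hPuN i) (holN i V) y < θN i}).indicator (1 : (Fin m₀ → ℝ) → ℝ≥0∞) x *
          ENNReal.ofReal (Real.exp (-((∑ p ∈ Pw, β * (1 - (Matrix.trace (Bp V p * holOf (ℓw p)
            (fun y => landauExp (landauCfBox P.L (Ubg V) k Sw Sw' (landauRad P.d P.L)) (kerOp (kι V)) (kerOp (kH V))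
              (4 * C2cov P.d * (ε₄w + B₀w * bw) ^ 2)
              (solAt (kerOp (k𝒢 V)) 0 (W𝒱w V) ε₄w (0 : Λz → ℭ) (kerOp (kH₁ V) (Tw V (cplx y))) +
                kerOp (kH₁ V) (Tw V (cplx y)))) x)).re /
            Fintype.card n)) +
          ((∑ i ∈ I, Ef i (WSup.toPiL (𝔄 := 𝔄) (pinW δ' ϖ) 1
            (landauExp (fun Y : WSup (pinW δ' ϖe₁) 1 𝔸 =>
            ((toPiL (pinW δ' ϖe₂) 1).symm (landauCf P.L (Ubg V) k Se Se' (toPiL (pinW δ' ϖe₁) 1 Y)) :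
              WSup (pinW δ' ϖe₂) 1 𝔸)) (ιe V) (He V)
            (4 * (C2cov P.d * Real.exp (2 * δ' * r₀e)) * (ε₄e + B₀e * be) ^ 2)
              (solAt (𝒢e V) 0 (W𝒱e V) ε₄e (0 : 𝒵e) (H₁e V (Te V (cplx x))) + H₁e V (Te V (cplx x)))))).re +
          (-Real.log (∫ ω, g ω * Real.exp (A V x ω) ∂μ)))))))
    (hudict : ∀ V, ∀ x ∈ cube m₀ S,
      u (fixTo (combBonds lo hi) 1 (updateFinset V Λ (expFibreChart Λ 1 e x))) =
        classifier hPu (fun p => holOf (ℓs p) (fun y => landauExp ((ball (0 : ↥Sf → 𝔸) (landauRad P.d P.L)).indicator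
            (landauCf P.L (1 : B7Prop1Explicit.Site P.d → Fin P.d → 𝔸ˣ) k Sf Sf')) (ιs V) (Hop V)
          (4 * C2cov P.d * (ε₄ + B₀ * (2 * dL * C₁ * ε₁)) ^ 2)
          (solAt (𝒢 V) 0 (W𝒱 V) ε₄ (0 : 𝒵) (H₁ V (T V (cplx y))) + H₁ V (T V (cplx y))))) x)
    (hδ0 : 0 ≤ δ) (hδ1 : δ < 1) (hρ0 : 0 ≤ ρ) (hρ : ρ ≤ (1 - δ) / 2) (hβ : 0 ≤ β)
    -- SM-L2 (SM) DISCHARGED IN THE STOKES CURRENCY (S73 `hSM_of_stokes`): the η-scalings of the classifier's read-out data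
    -- DISPLAYED — curl read-out × field size `κ_c·z̄ ≤ c₁η²z` (B11 (25)∕(37) TYPE), letter size `κ_r·z̄ ≤ c₂ηz` ((19) TYPE),
    -- regime `m·κ_r·z̄ ≤ 1` — the UNIT-currency smallness `36(c₁z + m²c₂²z²)∕(r_Φ∕S − 1)² ≤ δ·εθ`, and the classifier
    -- threshold `θ := εθ·η²` (B14 (2.17) TYPE): the `η²` CANCELS
    {η εθ c₁ c₂ z : ℝ} (hη : 0 < η) (hεθ : 0 < εθ)
    (hs₁ : κc * ((ε₄ + B₀ * (2 * dL * C₁ * ε₁)) + B₀ * (4 * C2cov P.d * (ε₄ + B₀ * (2 * dL * C₁ * ε₁)) ^ 2)) ≤ c₁ * η ^ 2 * z)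
    (ha : κr * ((ε₄ + B₀ * (2 * dL * C₁ * ε₁)) + B₀ * (4 * C2cov P.d * (ε₄ + B₀ * (2 * dL * C₁ * ε₁)) ^ 2)) ≤ c₂ * η * z)
    (hma : m * (κr * ((ε₄ + B₀ * (2 * dL * C₁ * ε₁)) + B₀ * (4 * C2cov P.d * (ε₄ + B₀ * (2 * dL * C₁ * ε₁)) ^ 2))) ≤ 1)
    (hsm : 36 * (c₁ * z + m ^ 2 * c₂ ^ 2 * z ^ 2) / (rΦ / S - 1) ^ 2 ≤ δ * εθ)
    -- THE DISPLAYED γ3 INPUT OF RECORD (N-ne7cp1-g32-2 ∕ N-ne7cp1-g33-2 «COLLAR»; leaf-01-g8 l.18489, leaf-08-g14 l.18568):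
    -- radius `(d−1)·nb·a ≤ 2 sin(S∕2)`, a cover of the box plaquettes by a CORE set (⊇ the plaquettes of `□^∼`) and a COLLAR
    -- set, and the PAIR of readings — «sub-threshold ⟹ core plaquettes `a`-small» (B14 (2.16)–(2.17) + average regularity
    -- [Balaban1985Averaging] Props 1∕2 TYPE, from `u < θ`) and «`F ≠ 0` ⟹ collar plaquettes `a`-small» (the density's KEPT
    -- co-tests, B15 (1.3)–(1.9) TYPE — a SUPPORT property); located, NOT asserted — REPLACE `hreach′` of file 1 (hence
    -- `hFsupp` of S80 f3); binder NAMES = S87 f4's (`hn hN hΛbox hΛcomb ha0 hrad hcover hcore hcollar`; the two plaquette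
    -- sets are called `Pcore`∕`Pcollar` here because S80 f3 already uses `A` for the (S78) dressed action)
    {a : ℝ} (ha0 : 0 ≤ a) (hrad : ((P.d - 1 : ℕ) : ℝ) * nb * a ≤ 2 * Real.sin (S / 2))
    {Pcore Pcollar : Set (Plaq P j)} (hcover : boxPlaqs lo hi ⊆ Pcore ∪ Pcollar)
    (hcore : ∀ (V : GaugeField P j SU2) (y : ↥Λ → SU2),
      u (fixTo (combBonds lo hi) 1 (updateFinset V Λ y)) < εθ * η ^ 2 →
        PlaqSmallOn Pcore a (fixTo (combBonds lo hi) 1 (updateFinset V Λ y)))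
    (hcollar : ∀ (V : GaugeField P j SU2) (y : ↥Λ → SU2),
      F (fixTo (combBonds lo hi) 1 (updateFinset V Λ y)) ≠ 0 →
        PlaqSmallOn Pcollar a (fixTo (combBonds lo hi) 1 (updateFinset V Λ y))) :
    SlotAntiConcentration ((fieldMeasure P j SU2).withDensity F) u (εθ * η ^ 2) ρ
      (2 * ((m₀ : ℝ) + (3 * (|β| * ((dbar +
          2 * (κcb * (cH₁ * MH₁ * bw / ((1 - c𝒢 * M𝒢 * (2 * C₄w * a₃w * Real.exp (δw * rW))) *
              (1 - 2 * C2cov P.d * landauRad P.d P.L * Real.exp (δw * rC) * (cι * Mι) * (cH * MH)))) +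
            expTail₂ (mw * (κwb * (cH₁ * MH₁ * bw / ((1 - c𝒢 * M𝒢 * (2 * C₄w * a₃w * Real.exp (δw * rW))) *
              (1 - 2 * C2cov P.d * landauRad P.d P.L * Real.exp (δw * rC) * (cι * Mι) * (cH * MH))))))) / (rΦw / S)) *
          (2 * (κcb * (cH₁ * MH₁ * bw / ((1 - c𝒢 * M𝒢 * (2 * C₄w * a₃w * Real.exp (δw * rW))) *
              (1 - 2 * C2cov P.d * landauRad P.d P.L * Real.exp (δw * rC) * (cι * Mι) * (cH * MH)))) +
            expTail₂ (mw * (κwb * (cH₁ * MH₁ * bw / ((1 - c𝒢 * M𝒢 * (2 * C₄w * a₃w * Real.exp (δw * rW))) *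
              (1 - 2 * C2cov P.d * landauRad P.d P.L * Real.exp (δw * rC) * (cι * Mι) * (cH * MH))))))) / (rΦw / S))) * Kw) +
        (3 * (LK * (2 * ((ε₄e + B₀e * be) + B₀e * (4 * (C2cov P.d * Real.exp (2 * δ' * r₀e)) * (ε₄e + B₀e * be) ^ 2)))) / (rΦe / S - 1) + Bd))) / (1 - δ))  := by
  -- three SIGN rows of (T3)∕(S78), DERIVED from rows already displayed (nothing enters)
  have he0 : ∀ i ∈ I, 0 ≤ ee i := fun i hi => (norm_nonneg _).trans (hEb i hi 0 (mem_ball_self hrE))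
  have hLK : 0 ≤ LK := (Finset.sum_nonneg fun i hi => by have := he0 i hi; positivity).trans hK
  have hBd0 : 0 ≤ Bd := by
    rcases isEmpty_or_nonempty Ω with hΩ | ⟨⟨ω⟩⟩
    · have h := hpos 1 0 (mem_closedBall_self hS.le) 1 (by norm_num) le_rfl
      simp [Measure.eq_zero_of_isEmpty μ] at h
    · have h := hA 1 0 (mem_closedBall_self hS.le) (1 / 2) le_rfl (by norm_num) ω
      simp only [smul_zero] at h
      linarith
  -- the three sup-norm operator rows of S104 f4, DERIVED: Schur test of the displayed decay rows (f1), then the number junctions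
  have h𝒢w : ∀ V f, ‖kerOp (k𝒢 V) f‖ ≤ B₀w * ‖f‖ :=
    norm_kerOp_le_of_decay_junction_family k𝒢 dis posz pos hc𝒢 hM𝒢 hδw hdis hk𝒢 hM𝒢' hB𝒢w
  have hH₁w : ∀ V B, ‖kerOp (kH₁ V) B‖ ≤ B₀w * ‖B‖ :=
    norm_kerOp_le_of_decay_junction_family kH₁ dis posb pos hcH₁ hMH₁ hδw hdis hkH₁ hMH₁' hBH₁w
  have hHw : ∀ V X, ‖kerOp (kH V) X‖ ≤ B₀w * ‖X‖ :=
    norm_kerOp_le_of_decay_junction_family kH dis posx pos hcH hMH hδw hdis hkH hMH' hBHw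
  exact slotAC_realized_su2_landauChart_assembled_decay_cfB7_lin_coTests
    hn hN Λ hΛbox hΛcomb e hS hSπ hF hFi hu hui hPu N hPuN holN hRN hθN hδ0N hδ1N hSMN hANN 𝒢 W𝒱 h𝒢 hW hB₀ hC₄ hε₄ hdL
    hC₁ hε₁ hB₃ h1 h2 h3 H₁ hH₁ T hTb hSr k Sf Sf' Sw Sw' Se Se' Ubg hUbg hα hα3 hα4 hα6 h52locw h52loce ϖe₁ ϖe₂ hϖe₁
    hϖe₂ hreache ιs hι Hop hH h18 hcoup h3R ℓs hκ hℓ hlen hκc hcurl hδw ϖw dis hϖw pos posz pos' posx posb k𝒢 kι kH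
    kH₁ hc𝒢 hM𝒢 hk𝒢 hM𝒢' hcι hMι hkι hMι' hcH hMH hkH hMH' hcH₁ hMH₁ hkH₁ hMH₁' W𝒱w h𝒢w hWw hB₀w hC₄w hε₄w hdomw
    hselfw hcontrw hH₁w Tw hTbw h2Sw hιw hHw hqw hRCw NW hlocW hreachW hreachC hsupp hqW hk Pw ℓw suppw ϖPw hblindw
    hdepthw hϖPw hκwb hκcb hℓwb hcurlw hlenw 𝓡𝒴w h𝓡𝒴w 𝓡𝒵w 𝓡ℬw h𝒢rw hWrw hιrw hHrw hH₁rw hTrw hskew Bp hBu hBd hd hdbar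
    hKw hδ' hϖ 𝒢e W𝒱e h𝒢e hWe hB₀e hC₄e hbe hε₄e hdome hselfe hcontre H₁e hH₁e Te hTbe hSre ιe hιe He hHe hqe hRCe I
    hrE hEd hEb he0 supp hblind ϖP hdepth hLK hK hcoupE hElb₁ μ hg A hBd0 hint hpos hA hElb₂ L 𝓡𝒵 𝓡ℬ h𝒢r hWr hιr hHr
    hH₁r hTr hRdict hudict hδ0 hδ1 hρ0 hρ hβ hη hεθ hs₁ ha hma hsm ha0 hrad hcover hcore hcollar

end Box

/-! ## §2 The entering rows are jointly inhabited with the host's `B₀w`-rows (crew rule G-1; owner header item (3), R-ne7cp1-g36-10 (b)) -/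

/-- **ONE-LINE NUMERIC INSTANCE** (sample values; the parametric statement for ANY values of the tree constants `C2cov d`,
`landauRad d L`, any Schur products `c·M·`, any `C₄w`, any pin factor `e^{δw rW}` is f1 §4 `ShellMeasureDecayKernelSchur.numberRows_inhabited`):
at `c𝒢M𝒢 = cH₁MH₁ = cHMH = B₀w = 1`, `C₄w = 1∕16`, `a₃w = 1`, `δw·rW = 0`, `ε₄w = bw = 1∕64` (so `ε₄w + B₀w·bw = 1∕32`), `C₂ = 3`, `R_C = 1∕5`
the entering rows `hB𝒢w hBH₁w hBHw` and the host's `hB₀w hε₄w hdomw hselfw hcontrw hqw hRCw hqW` hold together: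
`1 ≤ 1`, `0 < 1`, `0 ≤ 1∕64`, `1∕16 ≤ 1`, `1∕16384 ≤ 1∕64`, `1∕128 < 1`, `27∕32 < 1`, `3∕16 ≤ 1∕5`, `1∕8 < 1`. [folklore] -/
example :
    (1 : ℝ) * 1 ≤ 1 ∧ (1 : ℝ) * 1 ≤ 1 ∧ (1 : ℝ) * 1 ≤ 1 ∧ (0 : ℝ) < 1 ∧ (0 : ℝ) ≤ 1 / 64 ∧
      2 * ((1 : ℝ) / 64 + 1 * (1 / 64)) ≤ 1 ∧ (1 : ℝ) * (1 / 16) * (1 / 64 + 1 * (1 / 64)) ^ 2 ≤ 1 / 64 ∧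
      4 * (1 : ℝ) * (1 / 16) * (1 / 64 + 1 * (1 / 64)) < 1 ∧ 9 * (3 : ℝ) * 1 * (1 / 64 + 1 * (1 / 64)) < 1 ∧
      6 * ((1 : ℝ) / 64 + 1 * (1 / 64)) ≤ 1 / 5 ∧ (1 : ℝ) * 1 * (2 * (1 / 16) * 1 * Real.exp (0 * 0)) < 1 := by
  norm_num

end Summit.QuantumFields.BalabanUV.T4Continuum.ShellMeasureLandauEndAssembledDecayCfLinCoTestsSchur

end
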